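import Summits.Ventures.HodgeRepro.Night4ReducedDimEight
import Summits.Ventures.HodgeRepro.SingleClass

/-!
# Galois translation of a face: `dim B_red` is invariant, so every face reduces to one with first place `1`

Blind re-derivation cell `pub-hodge-repro`, seat `night-4` (ROUTE HARDENING for the Monday FINAL, gen 5).  Target tree
path `lean/Summits/Ventures/HodgeRepro/Night4ReducedDimTranslate.lean`.

Gens 1 and 4 put the reduced dimension `dim B_red` of every census face of degree 6, 8 and 10 on the kernel
(`Night4ReducedDimSix` / `…Eight` / `…EightAbelian` / `…Ten`), quantifying the two places of a face over a list of
place representatives (`redDim_faceCorners_of_reps`): for a group of order `2m` that is `m (m − 1)` ordered pairs of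
places per CM type, and at degree 12 (`m = 6`, 64 CM types, 30 pairs) the `decide +kernel` of one `(G, c)` would be
six pieces of ≈ 320 cases (gen 4's ADDENDUM 3: «≈ 2–3 files per pair, 12–18 files»).  This file removes a factor `m`:

* a Galois translate moves a face to a face — typer's `place_mul_left` / `flipAt_mul_left` / `faceCorners_mul_left`
  of `SingleClass.lean` (`faceCorners c (g • Φ) (g p) (g p′) = g • faceCorners c Φ p p′` corner by corner; the typer
  used the same symmetry to reduce «no face is single-class» to the faces `(Φ; 1, p′)`, `not_isSingleClass_of_one`);
* `dim B_red` is invariant under translating all four corners: the isogeny classes move along `g • ·`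
  (`rclass (g • T) = (rclass T).image (g • ·)`, the left and right actions commute, `smul_rmul`), the right stabilisers
  do not move at all (`rstab (g • T) = rstab T`), so `simpleDim` is unchanged and the class sum is unchanged
  (`redDim_smul`: the image of the class set under the injective map `(S, n) ↦ (S.image (g • ·), n)` has the same
  second-coordinate sum);
* **`redDim_faceCorners_of_base`**: every face `(Φ; p, p′)` is the translate by `p` of the face
  `(p⁻¹ • Φ; 1, p⁻¹ p′)`, so a property of `redDim (faceCorners c Φ 1 q)` checked for every CM type `Φ` and every
  second place `q` in a list of representatives holds for every face.  A degree-12 `(G, c)` is then ONE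
  `decide +kernel` of 64 × 5 cases (`Night4ReducedDimTwelve*.lean`).

Mathematically this is ROUTE.md §0's remark that the Galois action on the embeddings is LEFT translation and does not
change the isogeny class pattern of a corner product (the twist classes of §3 are right-translation orbits; left
translation is the Galois conjugation of the whole face).  Nothing here says anything about the status of the Hodge
conjecture for CM abelian varieties, which is NOT proved.
-/

set_option autoImplicit false

open Finset
open scoped Pointwise symmDiff

namespace HodgeRepro

section Translate

variable {G : Type} [Group G] [DecidableEq G]

/-- The right stabiliser of a Galois translate is the right stabiliser: `rstab (g • T) = rstab T`. -/
theorem rstab_smul (g : G) (T : Finset G) : rstab (g • T) = rstab T := by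
  ext h
  simp only [mem_rstab]
  rw [← smul_rmul]
  exact ⟨fun e => MulAction.injective g e, fun e => by rw [e]⟩

/-- `p′ ∉ place c p ↔ p⁻¹ p′ ∉ place c 1`. -/
theorem not_mem_place_iff_inv_mul {c : G} (hc : IsComplexConj c) (p p' : G) :
    p' ∉ place c p ↔ p⁻¹ * p' ∉ place c 1 := by
  have e : place c p = p • place c 1 := by rw [← place_mul_left hc, mul_one]
  rw [e]
  exact ⟨fun h hm => h (Finset.inv_smul_mem_iff.1 hm), fun h hm => h (Finset.inv_smul_mem_iff.2 hm)⟩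

variable [Fintype G]

/-- The isogeny class of a Galois translate is the translate of the isogeny class (the left and right actions
commute). -/
theorem rclass_smul (g : G) (T : Finset G) : rclass (g • T) = (rclass T).image (g • ·) := by
  unfold rclass
  rw [Finset.image_image]
  exact Finset.image_congr fun h _ => (smul_rmul g T h).symm

/-- The dimension of the simple factor is unchanged by a Galois translate. -/
theorem simpleDim_smul (g : G) (T : Finset G) : simpleDim (g • T) = simpleDim T := by
  have h : Fintype.card (rstab (g • T)) = Fintype.card (rstab T) :=
    Fintype.card_congr (Equiv.subtypeEquivRight fun h => by rw [rstab_smul g T])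
  unfold simpleDim
  rw [h]

/-- **`dim B_red` is invariant under a Galois translate of all four corners.** -/
theorem redDim_smul (g : G) (T : Fin 4 → Finset G) : redDim (fun i => g • T i) = redDim T := by
  have hinj : Function.Injective fun x : Finset (Finset G) × ℕ => (x.1.image (g • ·), x.2) := by
    intro x y e
    simp only [Prod.mk.injEq] at e
    exact Prod.ext (Finset.image_injective (MulAction.injective g) e.1) e.2
  have h : (univ.image fun i => (rclass (g • T i), simpleDim (g • T i)))
      = (univ.image fun i => (rclass (T i), simpleDim (T i))).image
          fun x : Finset (Finset G) × ℕ => (x.1.image (g • ·), x.2) := by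
    rw [Finset.image_image]
    exact Finset.image_congr fun i _ => by
      simp only [Function.comp_apply, rclass_smul, simpleDim_smul]
  simp only [redDim]
  rw [h, Finset.sum_image hinj.injOn]

/-- The reduced dimension of a translated face is that of the face. -/
theorem redDim_faceCorners_mul_left {c : G} (hc : IsComplexConj c) (g : G) (Φ : Finset G) (p p' : G) :
    redDim (faceCorners c (g • Φ) (g * p) (g * p')) = redDim (faceCorners c Φ p p') := by
  rw [faceCorners_mul_left hc, redDim_smul]

/-- **Reduction to first place `1`.**  If a list `reps` meets every place and a property `P` of
`redDim (faceCorners c Φ 1 q)` holds for every CM type `Φ` and every `q ∈ reps` outside the place of `1`, then it holds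
for every face `(Φ; p, p′)` of every CM type: the face is the translate by `p` of `(p⁻¹ • Φ; 1, p⁻¹ p′)`. -/
theorem redDim_faceCorners_of_base {c : G} (hc : IsComplexConj c) (reps : List G)
    (hcover : ∀ p : G, ∃ r ∈ reps, r = p ∨ c * r = p) (P : ℕ → Prop)
    (h : ∀ Φ ∈ cmTypes c, ∀ q ∈ reps, q ∉ place c 1 → P (redDim (faceCorners c Φ 1 q)))
    (Φ : Finset G) (hΦ : IsCMType c Φ) (p p' : G) (hp : p' ∉ place c p) :
    P (redDim (faceCorners c Φ p p')) := by
  have e : faceCorners c Φ p p' = faceCorners c (p • p⁻¹ • Φ) (p * 1) (p * (p⁻¹ * p')) := by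
    rw [mul_one, mul_inv_cancel_left, smul_inv_smul]
  rw [e, redDim_faceCorners_mul_left hc]
  have hq : p⁻¹ * p' ∉ place c 1 := (not_mem_place_iff_inv_mul hc p p').1 hp
  have hΨ : p⁻¹ • Φ ∈ cmTypes c := mem_cmTypes.2 (hΦ.smul hc p⁻¹)
  obtain ⟨r, hr, hrq⟩ := hcover (p⁻¹ * p')
  rcases hrq with hrq | hrq
  · rw [← hrq] at hq ⊢
    exact h _ hΨ r hr hq
  · rw [← hrq] at hq ⊢
    rw [faceCorners_conj_mul_right hc]
    exact h _ hΨ r hr fun hm => hq ((conj_mem_place_iff hc).2 hm)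

/-- The conjugate face `(c • Φ; p, p′)` — the face of the conjugate type, ROUTE.md §0 `Φ̄` — has the same reduced
dimension (`c` is the Galois translate by `c`, and `c p`, `c p′` are the same places). -/
theorem redDim_faceCorners_conj_smul {c : G} (hc : IsComplexConj c) (Φ : Finset G) (p p' : G) :
    redDim (faceCorners c (c • Φ) p p') = redDim (faceCorners c Φ p p') := by
  rw [← faceCorners_conj_mul_left hc (c • Φ) p p', ← faceCorners_conj_mul_right hc (c • Φ) (c * p) p',
    redDim_faceCorners_mul_left hc]

/-- **Reduction to first place `1` and types containing `1`.**  A CM type contains `1` or `c`; in the second case its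
conjugate contains `1` and has the same faces up to `redDim`.  So a property of `redDim (faceCorners c Φ 1 q)` checked
for the types `Φ ∋ 1` of a list `types` (which contains every such type) and the second places `q` of a list of
place representatives holds for every face of every CM type. -/
theorem redDim_faceCorners_of_base_one {c : G} (hc : IsComplexConj c) (reps : List G)
    (hcover : ∀ p : G, ∃ r ∈ reps, r = p ∨ c * r = p) (types : List (Finset G))
    (htypes : ∀ Φ : Finset G, IsCMType c Φ → (1 : G) ∈ Φ → Φ ∈ types) (P : ℕ → Prop)
    (h : ∀ Φ ∈ types, ∀ q ∈ reps, q ∉ place c 1 → P (redDim (faceCorners c Φ 1 q)))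
    (Φ : Finset G) (hΦ : IsCMType c Φ) (p p' : G) (hp : p' ∉ place c p) :
    P (redDim (faceCorners c Φ p p')) := by
  refine redDim_faceCorners_of_base hc reps hcover P ?_ Φ hΦ p p' hp
  intro Ψ hΨ q hq hne
  have hΨ' : IsCMType c Ψ := mem_cmTypes.1 hΨ
  by_cases h1 : (1 : G) ∈ Ψ
  · exact h Ψ (htypes Ψ hΨ' h1) q hq hne
  · have h1' : (1 : G) ∈ c • Ψ := by
      rw [hc.mem_smul_iff, mul_one]
      simpa only [mul_one] using (hΨ'.mem_or_conj_mem 1).resolve_left h1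
    rw [← redDim_faceCorners_conj_smul hc]
    exact h (c • Ψ) (htypes _ (hΨ'.conj hc) h1') q hq hne

end Translate

end HodgeRepro
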